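import Summits.CriticalPhenomena.CardyFormulaZ2.Theses.CardyQContinuation
import Literature.Probability.Percolation.DiscreteDomainPaths
import Literature.Probability.LatticeModels.MeshDomainJordan
import Literature.Probability.LatticeModels.ChamberManeuverDesign
import Literature.Probability.RandomPlanarGeometry.ExteriorULC

/-!
# Crux `IsingJetsConformal`, stub `stub_isingCrossingConformal_frontier_near_meshBoundary`:
# every boundary point of a conformal rectangle is near the discrete boundary of `Ω_δ`
# (route `CardyQContinuation`, item stmt-CriticalPhenomena-5560)

Any transplant of Chelkak–Smirnov's crossing theorem to the tree's discretisation of a Jordan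
conformal rectangle `R` (`meshDomain Ω δ`, the largest component of `δℤ² ∩ Ω`, with vertex
boundary `meshBoundary Ω δ`, `DomainDiscretisation.lean`) needs Hausdorff convergence of the
rescaled discrete boundary `δ · ∂Ω_δ` to `∂Ω`. One direction is
`Literature.Probability.Percolation.infDist_frontier_le_of_mem_meshBoundary` (every discrete
boundary vertex is within `δ` of `∂Ω`). This file proves the converse direction, uniformly in the
boundary point: for every `ε > 0`, for all small `δ > 0`, every `p ∈ ∂Ω` has a vertex of
`meshBoundary Ω δ` whose mesh point is within `ε` of `p`.

Proof. Pointwise (`eventually_exists_meshBoundary_near`, for any Jordan domain): near `p` pick an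
interior point `q` and — Jordan curve theorem, a theorem of the tree
(`JordanDomain.frontier_subset_closure_exterior'`) — an exterior point `e`, with closed balls of
radius `ρ` about them inside `Ω`, resp. outside `Ω̄`. For small `δ` the bulk property of the
discretisation of a Jordan domain (`JordanDomain.eventually_forall_mem_meshDomain'`,
`MeshDomainJordan.lean`) puts the nearest site `u` of `q` in `Ω_δ`, while the nearest site `v` of
`e` is not even a mesh vertex. A monotone lattice walk from `u` to `v`
(`ChamberDesign.exists_walk_box`) must therefore leave `Ω_δ`
(`Percolation.exists_exit_or_forall_mem` with every edge open), and it does so at a discrete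
boundary vertex, which lies in the bounding box of `u`, `v`, hence within `2 dist (δu, δv) + δ + ε`
of `p`. Uniformity: `∂Ω` is compact, so finitely many `ε/2`-balls about boundary points cover it,
and finitely many `∀ᶠ δ` conditions intersect (`Set.Finite.eventually_all`).

References: S. Smirnov, C. R. Acad. Sci. Paris 333 (2001), §2 (the discretisation);
D. Chelkak, S. Smirnov, Invent. Math. 189 (2012), §1.2, Thm. 6.1.
-/

namespace Summit.CriticalPhenomena.CardyFormulaZ2.Theorems.CardyQContinuation

open Set Metric Filter
open scoped Topology
open Literature.Probability.LatticeModels Literature.Probability.Percolation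
open Literature.Probability.RandomPlanarGeometry

noncomputable section

namespace FrontierNearMeshBoundary

/-- **A lattice walk from a vertex of `Ω_δ` to a vertex outside `Ω_δ` passes through the
discrete boundary `∂Ω_δ`**: the last vertex of `Ω_δ` before the first exit step is a discrete
boundary vertex (`exists_exit_or_forall_mem` with every edge open). [folklore] -/
theorem exists_mem_support_mem_meshBoundary {Ω : Set ℂ} {δ : ℝ} {u v : Site 2}
    (W : (zdGraph 2).Walk u v) (hu : u ∈ meshDomain Ω δ) (hv : v ∉ meshDomain Ω δ) :
    ∃ x ∈ W.support, x ∈ meshBoundary Ω δ := by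
  rcases exists_exit_or_forall_mem (ω := Set.univ) W hu (fun e _ => Set.mem_univ e) with
    h | ⟨h, -⟩
  · obtain ⟨x, y, hx, hxy, -, hxd, -, hnadj, -⟩ := h
    exact ⟨x, hx, hxd, y, hxy, hnadj⟩
  · exact absurd (h v W.end_mem_support).1 hv

/-- A lattice point in the coordinate bounding box of `u` and `v` has its mesh point within
`2 dist (δ v, δ u)` of `δ u` (`ℓ¹ ≤ 2 ℓ²` bookkeeping). [folklore] -/
theorem dist_meshPoint_le_two_mul_of_mem_box {δ : ℝ} (hδ : 0 < δ) {u v x : Site 2}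
    (h0 : min (u 0) (v 0) ≤ x 0) (h0' : x 0 ≤ max (u 0) (v 0))
    (h1 : min (u 1) (v 1) ≤ x 1) (h1' : x 1 ≤ max (u 1) (v 1)) :
    dist (meshPoint δ x) (meshPoint δ u) ≤ 2 * dist (meshPoint δ v) (meshPoint δ u) := by
  rw [dist_eq_norm, dist_eq_norm]
  have key : ∀ i : Fin 2, min (u i) (v i) ≤ x i → x i ≤ max (u i) (v i) →
      |δ * (x i : ℝ) - δ * u i| ≤ |δ * (v i : ℝ) - δ * u i| := by
    intro i hmin hmax
    have hint : |x i - u i| ≤ |v i - u i| := by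
      rcases abs_cases (v i - u i) with ⟨h, h'⟩ | ⟨h, h'⟩ <;> rw [h, abs_le] <;> omega
    have hreal : |(x i : ℝ) - u i| ≤ |(v i : ℝ) - u i| := by exact_mod_cast hint
    rw [← mul_sub, ← mul_sub, abs_mul, abs_mul, abs_of_pos hδ]
    exact mul_le_mul_of_nonneg_left hreal hδ.le
  have hre := key 0 h0 h0'
  have him := key 1 h1 h1'
  calc ‖meshPoint δ x - meshPoint δ u‖
      ≤ |(meshPoint δ x - meshPoint δ u).re| + |(meshPoint δ x - meshPoint δ u).im| :=
        Complex.norm_le_abs_re_add_abs_im _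
    _ ≤ |(meshPoint δ v - meshPoint δ u).re| + |(meshPoint δ v - meshPoint δ u).im| := by
        simp only [Complex.sub_re, Complex.sub_im, meshPoint_re, meshPoint_im]
        exact add_le_add hre him
    _ ≤ ‖meshPoint δ v - meshPoint δ u‖ + ‖meshPoint δ v - meshPoint δ u‖ :=
        add_le_add (Complex.abs_re_le_norm _) (Complex.abs_im_le_norm _)
    _ = 2 * ‖meshPoint δ v - meshPoint δ u‖ := by ring

/-- **Pointwise form**: for a Jordan domain `D`, a boundary point `p` and `η > 0`, for all small
`δ > 0` some discrete boundary vertex of `Ω_δ` has its mesh point within `η` of `p`. An interior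
point `q` and an exterior point `e` (Jordan curve theorem) within `η/8` of `p`; for small `δ`
the nearest site of `q` is in `Ω_δ` (bulk property of the discretisation of a Jordan domain)
and the nearest site of `e` is not a mesh vertex, so a monotone lattice walk between them exits
`Ω_δ` at a discrete boundary vertex inside their bounding box. [folklore] -/
theorem eventually_exists_meshBoundary_near (D : JordanDomain) {p : ℂ}
    (hp : p ∈ frontier D.carrier) {η : ℝ} (hη : 0 < η) :
    ∀ᶠ δ in 𝓝[>] (0 : ℝ), ∃ x ∈ meshBoundary D.carrier δ, dist (meshPoint δ x) p ≤ η := by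
  -- an interior point and an exterior point near `p`
  obtain ⟨q, hq, hpq⟩ : ∃ q ∈ D.carrier, dist p q < η / 8 :=
    Metric.mem_closure_iff.1 (frontier_subset_closure hp) _ (by positivity)
  obtain ⟨e, he, hpe⟩ : ∃ e ∈ (closure D.carrier)ᶜ, dist p e < η / 8 :=
    Metric.mem_closure_iff.1 (D.frontier_subset_closure_exterior' hp) _ (by positivity)
  -- room around them
  obtain ⟨ρ, hρ, hρq⟩ : ∃ ρ > 0, closedBall q ρ ⊆ D.carrier := by
    obtain ⟨r, hr, hrq⟩ := Metric.isOpen_iff.1 D.isOpen q hq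
    exact ⟨r / 2, by positivity, (closedBall_subset_ball (by linarith)).trans hrq⟩
  obtain ⟨ρ', hρ', hρe⟩ : ∃ ρ' > 0, closedBall e ρ' ⊆ (closure D.carrier)ᶜ := by
    obtain ⟨r, hr, hre⟩ := Metric.isOpen_iff.1 isClosed_closure.isOpen_compl e he
    exact ⟨r / 2, by positivity, (closedBall_subset_ball (by linarith)).trans hre⟩
  -- the bulk property of the discretisation on the compact `closedBall q ρ ⊆ Ω`
  have hbulk := D.eventually_forall_mem_meshDomain' (isCompact_closedBall q ρ) hρq
  have hsmall : ∀ᶠ δ in 𝓝[>] (0 : ℝ), δ ∈ Ioo 0 (min (min ρ ρ') (η / 20)) :=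
    Ioo_mem_nhdsGT (by positivity)
  filter_upwards [hbulk, hsmall] with δ hδb hδs
  obtain ⟨hδ, hδlt⟩ := hδs
  have hδρ : δ ≤ ρ := hδlt.le.trans ((min_le_left _ _).trans (min_le_left _ _))
  have hδρ' : δ ≤ ρ' := hδlt.le.trans ((min_le_left _ _).trans (min_le_right _ _))
  have hδη : δ ≤ η / 20 := hδlt.le.trans (min_le_right _ _)
  set u := nearestSite δ q with hu_def
  set v := nearestSite δ e with hv_def
  have huq : dist (meshPoint δ u) q ≤ δ := dist_meshPoint_nearestSite_le hδ q
  have hve : dist (meshPoint δ v) e ≤ δ := dist_meshPoint_nearestSite_le hδ e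
  have hu : u ∈ meshDomain D.carrier δ := hδb.1 u (mem_closedBall.2 (huq.trans hδρ))
  have hv : v ∉ meshDomain D.carrier δ := fun h =>
    hρe (mem_closedBall.2 (hve.trans hδρ')) (subset_closure (meshDomain_subset_meshVertices _ _ h))
  -- a monotone lattice walk from `u` to `v` exits `Ω_δ` through the discrete boundary
  obtain ⟨W, hW⟩ := ChamberDesign.exists_walk_box u v
  obtain ⟨x, hxW, hxb⟩ := exists_mem_support_mem_meshBoundary W hu hv
  refine ⟨x, hxb, ?_⟩
  obtain ⟨h0, h0', h1, h1'⟩ := hW x hxW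
  have hxu := dist_meshPoint_le_two_mul_of_mem_box hδ h0 h0' h1 h1'
  have t1 := dist_triangle (meshPoint δ v) e (meshPoint δ u)
  have t2 := dist_triangle e p (meshPoint δ u)
  have t3 := dist_triangle p q (meshPoint δ u)
  have t4 := dist_triangle (meshPoint δ x) (meshPoint δ u) p
  have t5 := dist_triangle (meshPoint δ u) q p
  have hpe' : dist e p < η / 8 := by rwa [dist_comm]
  have huq' : dist q (meshPoint δ u) ≤ δ := by rwa [dist_comm]
  have hpq' : dist q p < η / 8 := by rwa [dist_comm]
  linarith

end FrontierNearMeshBoundary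

open FrontierNearMeshBoundary

/-- **Stub `stub_isingCrossingConformal_frontier_near_meshBoundary`** of the skeleton of the crux
`IsingJetsConformal` (stmt-CriticalPhenomena-5560): the converse half of the Hausdorff
convergence `δ · ∂Ω_δ → ∂Ω` of the discrete boundary of the tree's discretisation of a conformal
rectangle — for every `ε > 0`, for all small `δ > 0`, every boundary point `p ∈ ∂Ω` has a vertex
of `meshBoundary Ω δ` whose mesh point is within `ε` of `p` (uniformly in `p`: compactness of
`∂Ω` and the pointwise form `eventually_exists_meshBoundary_near`). [folklore] -/
theorem stub_isingCrossingConformal_frontier_near_meshBoundary : (∀ (R : Literature.Probability.RandomPlanarGeometry.ConformalRectangle) (ε : ℝ), 0 < ε → ∀ᶠ δ in nhdsWithin (0:ℝ) (Set.Ioi 0), ∀ p ∈ frontier R.carrier, ∃ x ∈ Literature.Probability.LatticeModels.meshBoundary R.carrier δ, dist (Literature.Probability.LatticeModels.meshPoint δ x) p ≤ ε) := by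
  intro R ε hε
  have hcpt : IsCompact (frontier R.carrier) :=
    isCompact_of_isClosed_isBounded isClosed_frontier
      (R.isBounded.closure.subset frontier_subset_closure)
  obtain ⟨t, hts, htf, hcover⟩ := hcpt.finite_cover_balls (e := ε / 2) (by positivity)
  have key : ∀ᶠ δ in 𝓝[>] (0 : ℝ), ∀ p ∈ t,
      ∃ x ∈ meshBoundary R.carrier δ, dist (meshPoint δ x) p ≤ ε / 2 :=
    htf.eventually_all.2 fun p hp =>
      eventually_exists_meshBoundary_near R.toJordanDomain (hts hp) (by positivity)
  filter_upwards [key] with δ hδ p hp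
  obtain ⟨p', hp't, hpp'⟩ : ∃ p' ∈ t, p ∈ ball p' (ε / 2) := by
    simpa only [mem_iUnion, exists_prop] using hcover hp
  obtain ⟨x, hxb, hx⟩ := hδ p' hp't
  refine ⟨x, hxb, ?_⟩
  rw [mem_ball] at hpp'
  linarith [dist_triangle (meshPoint δ x) p' p, dist_comm p p']

end

end Summit.CriticalPhenomena.CardyFormulaZ2.Theorems.CardyQContinuation
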